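import Summits.BirchSwinnertonDyer.BirchSwinnertonDyer.Theorems.ByReductionTypeAtTwoAdditiveCubicResolventIdentity
import HarnessLib

/-!
# Route `ByReductionTypeAtTwo` (rung K4), crux `AdditiveRankZeroAtTwo` (item
# stmt-BirchSwinnertonDyer-19098): the CUBIC-RESOLVENT DESCENT, part 3 — the DOORS (any prime `p`)
# and their closed forms (`L` discharged by the tree's `exists_resolventClosure`, GZK for `Ш/ℚ`)

HONEST FRAMING (cell `bsd-2adic`, run/shared/lean/pub/bsd-2adic/, HUMAN RULINGS D-0036/D-0074;
seat `bsd-2adic-addL2x` GEN 3, WIDTH-LEVER lane B «semistable base change to the field of good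
reduction + Kato over that field + norm descent»): theorems only; NO new definition, NO new named
fact in this file (the PRINT inputs are consumed BY NAME: modularity `hmod`, Milne 1972 `hMilneC`,
Dokchitser–Dokchitser 2010 Thm. 2.3 `hDD`, Artin formalism `hArtin`, base change for `GL(2)`
`hBC3`/`hBC6` — the last four from `Literature/…/CubicResolventArtinFormalismBSDQuotient.lean`,
p544626); nothing asserted; no class closed; nothing booked; BSD is not proved by any of this.
PARTITION (D-0054): X5@2 ADDITIVE, defect-`≥ 3` sub-class (B1·O1; 1 382 classes; the odd core `C₃`
454 is where the reading «good reduction over `F`» applies) × p = 2 — types-the-object-of; closes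
none. bears_on: K4 (crux `AdditiveRankZeroAtTwo`, item stmt-BirchSwinnertonDyer-19098).

THE DOORS (from part 2's `sha_sq_identity`; `δ_p(X) := ord_p #Ш_an(X) − ord_p #Ш(X)`):
* `defect_eq_of_descent` / `defect_eq_of_cubicResolvent` — **(★★)
  `δ_p(E/ℚ) − δ_p(E^{(d_K)}/ℚ) = δ_p(E_F) − δ_p(E^{(d_K)}_F)`** for ANY prime `p`, ANY quadratic `K`
  and ANY cubic field `F` with `d_F = d_K f²`; `exists_shaAn_eq_of_descent` (rationality descends);
* Door A `missingPPartAt_of_twist_of_overF` / `bsdp_of_twist_of_overCubicResolvent`: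
  `BSD(E^{(d_K)},p) ∧ MissingPPartOverCAt VF p ∧ MissingPPartOverCAt VF' p ⟹ BSD(E,p)`;
* Door B `…pair_of_overF_of_upper_lower` (+ mirror) / `bsdp_pair_of_overCubicResolvent_…`:
  the two `p`-parts over `F` + opposite one-sided halves over `ℚ` ⟹ `BSD(E,p) ∧ BSD(E^{(d_K)},p)`;
* Door C `missingPPartAt_iff_defect_overF_eq` / `bsdp_iff_defect_overCubicResolvent_eq`:
  granted `BSD(E^{(d_K)},p)`, **`BSD(E,p) ⟺ δ_p(VF) = δ_p(VF')`** (EXACTNESS).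

READING FOR THE CRUX (p = 2, defect-`≥ 3` block; GEN 2's census: 1 381 / 1 382 block classes have an
inert `D ≡ 5 (mod 8)` of record, `|D| ≤ 301`, with `E^{(D)}` of analytic rank `0` DECIDED at level
`0` — `Ш(E^{(D)})[2] = 0`, `#Ш_an` odd — hence `BSD(E^{(D)},2)` outright): per class, for ANY cubic
field `F` of discriminant `D·f²` (such `F` has `2 = 𝔓³` iff `2 ∣ f`; e.g. the pure cubic fields
`ℚ(∛(2m))` for `D = −3`, the field of discriminant `148` for `D = 37`),
**`BSD(E,2) ⟺ δ₂(E_F) = δ₂(E^{(D)}_F) ⟸` the `2`-part of BSD for `E` and `E^{(D)}` over `F`**, where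
for `Φ(E,2) = C₃` (454 classes) and `2 ∣ f` BOTH `E_F` and `E^{(D)}_F` have GOOD supersingular
reduction at `𝔓` (`e = 3`, `f = 1`): the additive prime has left the residual object, which is
W-addL2x-1 of GEN 0 («BSD₂ / signed Iwasawa theory at a prime of good supersingular reduction over a
base RAMIFIED at `2`», not in print) — now shown SUFFICIENT per class, the descent costing only
PRINT. Compare GEN 2's exactness `BSD(E,2) ⟺ hKC at ℚ(√D)` (`E_K` still ADDITIVE at `(2)`). At the
∀-level the door trades `hU3`/`hL3` for the over-`F` input only together with `hKC` (no anchor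
without a decided twist); a cubic-field SUPPLY («∀ K with 2 inert ∃ F with d_F = d_K·(2m)²», Hasse
1930 / CFT) would be needed to state it ∀-closed and is NOT claimed here.
WHAT THIS IS NOT: not a proof of any `2`-part; not a statement about `Φ ∈ {C₄, Q₈, SL₂(𝔽₃)}`
(the identity holds there too, but `E_F` stays additive); no per-class file is produced here.
-/

set_option autoImplicit false
-- the Theorems namespace of this sub repeats the summit name by design (D-0017 nested layout)
set_option linter.dupNamespace false

noncomputable section

open scoped Classical

open WeierstrassCurve Literature.NumberTheory.EllipticCurves
  Literature.NumberTheory.EllipticCurves.Rank1Residual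
  Literature.NumberTheory.EllipticCurves.Rank1Residual.Typed
  Summit.BirchSwinnertonDyer.Rank1Residual.AdditivePotMult

namespace Summit.BirchSwinnertonDyer.BirchSwinnertonDyer.Theorems.CubicResolvent

/-! ## §5 The doors (any prime `p`): valuation algebra on the MAIN IDENTITY

All theorems of this section take the same nineteen hypotheses (section variables, `include`d):
the six PRINT named facts — modularity `hmod`, Milne 1972 `hMilneC`, Dokchitser–Dokchitser 2010
Thm. 2.3 `hDD`, Artin formalism `hArtin`, base change `hBC3` / `hBC6` —, the `S₃` configuration
(`hK2`, `hF3`, `hf`, `hdisc`, `hL6`, `hGal`), the models (`hWd`, `hVF`, `hVF'`) and finiteness of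
the four `Ш` (`hshaW`, `hshaWd` — Gross–Zagier–Kolyvagin in rank `≤ 1` —, `hshaF`, `hshaF'` — part of
any `p`-part statement over `F`). -/

section Doors

variable {W : WeierstrassCurve ℚ} [W.IsElliptic] [W.IsGloballyMinimal]
  {Wd : WeierstrassCurve ℚ} [Wd.IsElliptic] [Wd.IsGloballyMinimal] (p : ℕ) [Fact p.Prime]
  {K : Type} [Field K] [NumberField K] {F : Type} [Field F] [NumberField F]
  {L : Type} [Field L] [NumberField L] [Algebra F L] [Algebra K L]
  {VF : WeierstrassCurve F} [VF.IsElliptic] {VF' : WeierstrassCurve F} [VF'.IsElliptic]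
  (hmod : hasEntireLFunction_rat)
  (hMilneC : Milne1972.bsdQuotient_baseChange_quadratic_anyModel)
  (hDD : DokchitserDokchitser2010.bsdQuotient_brauerS3_anyModel) (hArtin : LSeries_brauerS3)
  (hBC3 : hasEntireLFunction_baseChange_cubic)
  (hBC6 : hasEntireLFunction_baseChange_of_isGalois_six)
  (hK2 : Module.finrank ℚ K = 2) (hF3 : Module.finrank ℚ F = 3) {f : ℤ} (hf : f ≠ 0)
  (hdisc : NumberField.discr F = NumberField.discr K * f ^ 2)
  (hL6 : Module.finrank ℚ L = 6) (hGal : IsGalois ℚ L)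
  (hWd : ∃ C : VariableChange ℚ, C • W.quadraticTwist (NumberField.discr K : ℚ) = Wd)
  (hVF : ∃ C : VariableChange F, C • W.baseChange F = VF)
  (hVF' : ∃ C : VariableChange F, C • Wd.baseChange F = VF')
  (hshaW : W.ShaFinite) (hshaWd : Wd.ShaFinite) (hshaF : VF.ShaFinite) (hshaF' : VF'.ShaFinite)

include hBC3 hF3 hVF' hshaF' in
omit [Fact p.Prime] [W.IsElliptic] [W.IsGloballyMinimal] [Wd.IsGloballyMinimal] [NumberField K]
  [Field K] [Algebra F L] [Algebra K L] [NumberField L] [Field L] [VF.IsElliptic] in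
/-- `#Ш_an(VF') ≠ 0` (its product with the positive quotient is `ℓ(VF')·#Ш(VF')`, both non-zero:
`ℓ ≠ 0` for an entire `L`-function, `hBC3`). [folklore] -/
theorem shaAnOverC_twist_ne_zero : shaAnOverC VF' ≠ 0 := by
  obtain ⟨C, hC⟩ := hVF'
  have hent : VF'.HasEntireLFunction := by
    rw [← hC, hasEntireLFunction_smul_iff]; exact hBC3 Wd F hF3
  have hℓ : VF'.leadingLCoeff ≠ 0 := VF'.leadingLCoeff_ne_zero_holds hent
  have hn : (VF'.shaOrder : ℂ) ≠ 0 := by exact_mod_cast (VF'.shaOrder_pos hshaF').ne'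
  intro h0
  have := shaAnOverC_mul_quotient (M := F) VF'
  rw [h0, zero_mul] at this
  exact mul_ne_zero hℓ hn this.symm

include hmod hMilneC hDD hArtin hBC3 hBC6 hK2 hF3 hf hdisc hL6 hGal hWd hVF hVF' hshaW hshaWd hshaF
  hshaF'

omit [Fact p.Prime] in
/-- **Rationality of `#Ш_an(E/ℚ)` by descent**: if `#Ш_an(Wd)`, `#Ш_an(VF)`, `#Ш_an(VF')` are
rational then so is `#Ш_an(W)` (up to the sign ambiguity of the squared identity, harmless for
`p`-adic valuations). [folklore] -/
theorem exists_shaAn_eq_of_descent {qd qF qF' : ℚ}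
    (hqd : shaAn Wd = (qd : ℂ)) (hqF : shaAnOverC VF = (qF : ℂ))
    (hqF' : shaAnOverC VF' = (qF' : ℂ)) :
    ∃ q : ℚ, shaAn W = (q : ℂ) ∧
      padicValRat p q = padicValRat p (qd * qF * W.shaOrder * VF'.shaOrder /
        (qF' * Wd.shaOrder * VF.shaOrder)) := by
  have hid := sha_sq_identity W Wd K F L VF VF' hmod hMilneC hDD hArtin hBC3 hBC6 hK2
    hF3 hf hdisc hL6 hGal hWd hVF hVF' hshaW hshaWd hshaF hshaF'
  have hqF'0 : (qF' : ℂ) ≠ 0 := by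
    rw [← hqF']; exact shaAnOverC_twist_ne_zero hBC3 hF3 hVF' hshaF'
  have hnWd : (Wd.shaOrder : ℂ) ≠ 0 := by exact_mod_cast (Wd.shaOrder_pos hshaWd).ne'
  have hnF : (VF.shaOrder : ℂ) ≠ 0 := by exact_mod_cast (VF.shaOrder_pos hshaF).ne'
  set r : ℚ := qd * qF * W.shaOrder * VF'.shaOrder / (qF' * Wd.shaOrder * VF.shaOrder) with hr
  have hsq : shaAn W ^ 2 = (r : ℂ) ^ 2 := by
    have hden : ((qF' : ℂ) * (Wd.shaOrder : ℂ) * (VF.shaOrder : ℂ)) ≠ 0 :=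
      mul_ne_zero (mul_ne_zero hqF'0 hnWd) hnF
    rw [hr]
    push_cast
    rw [div_pow, eq_div_iff (pow_ne_zero _ hden), ← mul_pow]
    rw [hqd, hqF, hqF'] at hid
    linear_combination hid
  rcases sq_eq_sq_iff_eq_or_eq_neg.mp hsq with h | h
  · exact ⟨r, h, rfl⟩
  · exact ⟨-r, by rw [h, Rat.cast_neg], by rw [padicValRat.neg]⟩

/-- **The defect identity (★★), any prime `p`.** With `δ_p(X) := ord_p #Ш_an(X) − ord_p #Ш(X)`
(rational `#Ш_an`): `δ_p(E/ℚ) − δ_p(E^{(d_K)}/ℚ) = δ_p(E_F) − δ_p(E^{(d_K)}_F)` — the `S₃` Brauer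
relation for `E` minus the one for `E^{(d_K)}` (Dokchitser–Dokchitser 2010 Thm. 2.3 + Artin
formalism), in which `BSD(E_L)`, `BSD(E_K)` and the abelian surface `E ⊗ ρ` cancel. [folklore] -/
theorem defect_eq_of_descent {q qd qF qF' : ℚ}
    (hq : shaAn W = (q : ℂ)) (hqd : shaAn Wd = (qd : ℂ)) (hqF : shaAnOverC VF = (qF : ℂ))
    (hqF' : shaAnOverC VF' = (qF' : ℂ)) :
    (padicValRat p q - padicValNat p W.shaOrder) - (padicValRat p qd - padicValNat p Wd.shaOrder) =
      (padicValRat p qF - padicValNat p VF.shaOrder) -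
        (padicValRat p qF' - padicValNat p VF'.shaOrder) := by
  have hid := sha_sq_identity W Wd K F L VF VF' hmod hMilneC hDD hArtin hBC3 hBC6 hK2
    hF3 hf hdisc hL6 hGal hWd hVF hVF' hshaW hshaWd hshaF hshaF'
  rw [hq, hqd, hqF, hqF'] at hid
  have hQ : (q * qF' * Wd.shaOrder * VF.shaOrder) ^ 2 = (qd * qF * W.shaOrder * VF'.shaOrder) ^ 2 := by
    have h : (((q * qF' * Wd.shaOrder * VF.shaOrder) ^ 2 : ℚ) : ℂ) =
        (((qd * qF * W.shaOrder * VF'.shaOrder) ^ 2 : ℚ) : ℂ) := by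
      push_cast; exact hid
    exact_mod_cast h
  have hq0 : q ≠ 0 := by
    intro h0; apply shaAn_ne_zero W hmod; rw [hq, h0, Rat.cast_zero]
  have hqd0 : qd ≠ 0 := by
    intro h0; apply shaAn_ne_zero Wd hmod; rw [hqd, h0, Rat.cast_zero]
  have hqF'0 : qF' ≠ 0 := by
    intro h0; apply shaAnOverC_twist_ne_zero hBC3 hF3 hVF' hshaF'; rw [hqF', h0, Rat.cast_zero]
  have hnW : (W.shaOrder : ℚ) ≠ 0 := by exact_mod_cast (W.shaOrder_pos hshaW).ne'
  have hnWd : (Wd.shaOrder : ℚ) ≠ 0 := by exact_mod_cast (Wd.shaOrder_pos hshaWd).ne'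
  have hnF : (VF.shaOrder : ℚ) ≠ 0 := by exact_mod_cast (VF.shaOrder_pos hshaF).ne'
  have hnF' : (VF'.shaOrder : ℚ) ≠ 0 := by exact_mod_cast (VF'.shaOrder_pos hshaF').ne'
  have hqF0 : qF ≠ 0 := by
    intro h0
    rw [h0, mul_zero, zero_mul, zero_mul, zero_pow two_ne_zero] at hQ
    exact pow_ne_zero 2 (mul_ne_zero (mul_ne_zero (mul_ne_zero hq0 hqF'0) hnWd) hnF) hQ
  have hv := congrArg (padicValRat p) hQ
  rw [padicValRat.pow, padicValRat.pow,
    padicValRat.mul (mul_ne_zero (mul_ne_zero hq0 hqF'0) hnWd) hnF,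
    padicValRat.mul (mul_ne_zero hq0 hqF'0) hnWd, padicValRat.mul hq0 hqF'0,
    padicValRat.mul (mul_ne_zero (mul_ne_zero hqd0 hqF0) hnW) hnF',
    padicValRat.mul (mul_ne_zero hqd0 hqF0) hnW, padicValRat.mul hqd0 hqF0,
    padicValRat.of_nat, padicValRat.of_nat, padicValRat.of_nat, padicValRat.of_nat] at hv
  push_cast at hv ⊢
  linarith

/-- **Door A (any `p`): `p`-part for `E^{(d_K)}` over `ℚ` and for `E`, `E^{(d_K)}` over the cubic
field `F` ⟹ `p`-part for `E` over `ℚ`.** In the `2`-adic application `E`, `E^{(d_K)}` are additive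
at `2` with `Φ = C₃` while `E_F`, `E^{(d_K)}_F` have GOOD reduction at the prime `𝔓`, `𝔓³ = (2)`,
of `F`: the additive prime has left the residual object. [folklore] -/
theorem missingPPartAt_of_twist_of_overF
    (hd : MissingPPartAt Wd p) (hF : MissingPPartOverCAt VF p) (hF' : MissingPPartOverCAt VF' p) :
    MissingPPartAt W p := by
  obtain ⟨qd, hqd, hvd⟩ := hd
  obtain ⟨qF, hqF, hvF⟩ := hF
  obtain ⟨qF', hqF', hvF'⟩ := hF'
  obtain ⟨q, hq, -⟩ := exists_shaAn_eq_of_descent p hmod hMilneC hDD hArtin hBC3 hBC6 hK2 hF3 hf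
    hdisc hL6 hGal hWd hVF hVF' hshaW hshaWd hshaF hshaF' hqd hqF hqF'
  refine ⟨q, hq, ?_⟩
  have h := defect_eq_of_descent p hmod hMilneC hDD hArtin hBC3 hBC6 hK2 hF3 hf hdisc hL6 hGal hWd
    hVF hVF' hshaW hshaWd hshaF hshaF' hq hqd hqF hqF'
  linarith

/-- **Door B (any `p`, one-sided): `p`-parts over `F` for `E` and `E^{(d_K)}` + the UPPER half
for `E` + the LOWER half for `E^{(d_K)}` over `ℚ` ⟹ the `p`-part for BOTH `E` and `E^{(d_K)}`**
(the defects are equal and of opposite signs). [folklore] -/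
theorem missingPPartAt_pair_of_overF_of_upper_lower
    (hF : MissingPPartOverCAt VF p) (hF' : MissingPPartOverCAt VF' p)
    (hu : MissingUpperBoundAt W p) (hl : MissingLowerBoundAt Wd p) :
    MissingPPartAt W p ∧ MissingPPartAt Wd p := by
  obtain ⟨q, hq, hge⟩ := hu
  obtain ⟨qd, hqd, hle⟩ := hl
  obtain ⟨qF, hqF, hvF⟩ := hF
  obtain ⟨qF', hqF', hvF'⟩ := hF'
  have h := defect_eq_of_descent p hmod hMilneC hDD hArtin hBC3 hBC6 hK2 hF3 hf hdisc hL6 hGal hWd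
    hVF hVF' hshaW hshaWd hshaF hshaF' hq hqd hqF hqF'
  exact ⟨⟨q, hq, by linarith⟩, ⟨qd, hqd, by linarith⟩⟩

/-- Door B, mirrored halves (LOWER for `E`, UPPER for `E^{(d_K)}`). [folklore] -/
theorem missingPPartAt_pair_of_overF_of_lower_upper
    (hF : MissingPPartOverCAt VF p) (hF' : MissingPPartOverCAt VF' p)
    (hl : MissingLowerBoundAt W p) (hu : MissingUpperBoundAt Wd p) :
    MissingPPartAt W p ∧ MissingPPartAt Wd p := by
  obtain ⟨q, hq, hle⟩ := hl
  obtain ⟨qd, hqd, hge⟩ := hu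
  obtain ⟨qF, hqF, hvF⟩ := hF
  obtain ⟨qF', hqF', hvF'⟩ := hF'
  have h := defect_eq_of_descent p hmod hMilneC hDD hArtin hBC3 hBC6 hK2 hF3 hf hdisc hL6 hGal hWd
    hVF hVF' hshaW hshaWd hshaF hshaF' hq hqd hqF hqF'
  exact ⟨⟨q, hq, by linarith⟩, ⟨qd, hqd, by linarith⟩⟩

/-- **Door C (exactness, any `p`): granted the `p`-part for `E^{(d_K)}` over `ℚ`, the `p`-part for
`E` over `ℚ` holds IFF the `p`-adic defects of `E_F` and `E^{(d_K)}_F` agree** — in particular it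
follows from, and is no stronger than, the two `p`-parts over the cubic field `F`. [folklore] -/
theorem missingPPartAt_iff_defect_overF_eq
    (hd : MissingPPartAt Wd p) {qF qF' : ℚ} (hqF : shaAnOverC VF = (qF : ℂ))
    (hqF' : shaAnOverC VF' = (qF' : ℂ)) :
    MissingPPartAt W p ↔
      padicValRat p qF - padicValNat p VF.shaOrder =
        padicValRat p qF' - padicValNat p VF'.shaOrder := by
  obtain ⟨qd, hqd, hvd⟩ := hd
  constructor
  · rintro ⟨q, hq, hv⟩
    have h := defect_eq_of_descent p hmod hMilneC hDD hArtin hBC3 hBC6 hK2 hF3 hf hdisc hL6 hGal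
      hWd hVF hVF' hshaW hshaWd hshaF hshaF' hq hqd hqF hqF'
    linarith
  · intro heq
    obtain ⟨q, hq, -⟩ := exists_shaAn_eq_of_descent p hmod hMilneC hDD hArtin hBC3 hBC6 hK2 hF3 hf
      hdisc hL6 hGal hWd hVF hVF' hshaW hshaWd hshaF hshaF' hqd hqF hqF'
    refine ⟨q, hq, ?_⟩
    have h := defect_eq_of_descent p hmod hMilneC hDD hArtin hBC3 hBC6 hK2 hF3 hf hdisc hL6 hGal
      hWd hVF hVF' hshaW hshaWd hshaF hshaF' hq hqd hqF hqF'
    linarith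

end Doors

/-! ## §6 The doors with the sextic `L` discharged (the tree's `exists_resolventClosure`) and in
`BSD(E,p)` form (Gross–Zagier–Kolyvagin for the rank and the finiteness over `ℚ`) -/

section Closed

open Literature.NumberTheory.CubicFields

variable {W : WeierstrassCurve ℚ} [W.IsElliptic] [W.IsGloballyMinimal]
  {Wd : WeierstrassCurve ℚ} [Wd.IsElliptic] [Wd.IsGloballyMinimal] (p : ℕ) [Fact p.Prime]
  {K : Type} [Field K] [NumberField K] {F : Type} [Field F] [NumberField F]
  {VF : WeierstrassCurve F} [VF.IsElliptic] {VF' : WeierstrassCurve F} [VF'.IsElliptic]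
  (hGZK : rank_eq_analyticRank_of_analyticRank_le_one) (hmod : hasEntireLFunction_rat)
  (hMilneC : Milne1972.bsdQuotient_baseChange_quadratic_anyModel)
  (hDD : DokchitserDokchitser2010.bsdQuotient_brauerS3_anyModel) (hArtin : LSeries_brauerS3)
  (hBC3 : hasEntireLFunction_baseChange_cubic)
  (hBC6 : hasEntireLFunction_baseChange_of_isGalois_six)
  (hK2 : Module.finrank ℚ K = 2) (hF3 : Module.finrank ℚ F = 3) {f : ℤ} (hf : f ≠ 0)
  (hdisc : NumberField.discr F = NumberField.discr K * f ^ 2)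
  (hWd : ∃ C : VariableChange ℚ, C • W.quadraticTwist (NumberField.discr K : ℚ) = Wd)
  (hVF : ∃ C : VariableChange F, C • W.baseChange F = VF)
  (hVF' : ∃ C : VariableChange F, C • Wd.baseChange F = VF')
  (hr : W.analyticRank ≤ 1) (hrd : Wd.analyticRank ≤ 1)
  (hshaF : VF.ShaFinite) (hshaF' : VF'.ShaFinite)

include hGZK hmod hMilneC hDD hArtin hBC3 hBC6 hK2 hF3 hf hdisc hWd hVF hVF' hr hrd hshaF hshaF'

/-- **The defect identity with `L` discharged.** For `W`, `Wd` globally minimal of analytic rank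
`≤ 1` (`Ш` finite over `ℚ` by Gross–Zagier–Kolyvagin), `K` quadratic, `F` a cubic field with
`d_F = d_K f²` (its `S₃`-closure `L = F·K` is supplied by the tree's `exists_resolventClosure`),
models `VF`, `VF'` of `E_F`, `E^{(d_K)}_F` with finite `Ш`, and rational `#Ш_an`'s:
`δ_p(E/ℚ) − δ_p(E^{(d_K)}/ℚ) = δ_p(E_F) − δ_p(E^{(d_K)}_F)`. [folklore] -/
theorem defect_eq_of_cubicResolvent {q qd qF qF' : ℚ}
    (hq : shaAn W = (q : ℂ)) (hqd : shaAn Wd = (qd : ℂ)) (hqF : shaAnOverC VF = (qF : ℂ))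
    (hqF' : shaAnOverC VF' = (qF' : ℂ)) :
    (padicValRat p q - padicValNat p W.shaOrder) - (padicValRat p qd - padicValNat p Wd.shaOrder) =
      (padicValRat p qF - padicValNat p VF.shaOrder) -
        (padicValRat p qF' - padicValNat p VF'.shaOrder) := by
  obtain ⟨L, hfd, h3, hab, hgal, h6, ⟨ι⟩, -⟩ := exists_resolventClosure hK2 F hF3 hf hdisc
  haveI := hfd
  haveI : FiniteDimensional ℚ L := Module.Finite.trans K L
  haveI : CharZero L := charZero_of_injective_algebraMap (algebraMap K L).injective
  haveI : NumberField L := NumberField.mk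
  letI : Algebra F L := ι.toRingHom.toAlgebra
  have hshaW : W.ShaFinite := (hGZK W hr).2
  have hshaWd : Wd.ShaFinite := (hGZK Wd hrd).2
  exact defect_eq_of_descent (L := L) p hmod hMilneC hDD hArtin hBC3 hBC6 hK2 hF3 hf hdisc h6 hgal
    hWd hVF hVF' hshaW hshaWd hshaF hshaF' hq hqd hqF hqF'

/-- **Door A, closed form (any `p`): `BSD(E^{(d_K)}, p)` + the `p`-parts of BSD for `E` and
`E^{(d_K)}` over ONE cubic field `F` with `d_F = d_K f²` ⟹ `BSD(E, p)`.** For the crux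
`AdditiveRankZeroAtTwo` (item stmt-BirchSwinnertonDyer-19098) at `p = 2` this is the per-class
door of the «field of good reduction» road on the odd core: `E` with `Φ(E,2) = C₃`, `K = ℚ(√D)`
with `2` inert and `E^{(D)}` decided, `F` with `2 = 𝔓³` — then `E_F`, `E^{(D)}_F` have GOOD
(supersingular) reduction at `𝔓` and nothing at an additive prime is left in the hypotheses.
[folklore] -/
theorem bsdp_of_twist_of_overCubicResolvent (hd : BSDp Wd p) (hF : MissingPPartOverCAt VF p)
    (hF' : MissingPPartOverCAt VF' p) : BSDp W p := by
  obtain ⟨L, hfd, h3, hab, hgal, h6, ⟨ι⟩, -⟩ := exists_resolventClosure hK2 F hF3 hf hdisc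
  haveI := hfd
  haveI : FiniteDimensional ℚ L := Module.Finite.trans K L
  haveI : CharZero L := charZero_of_injective_algebraMap (algebraMap K L).injective
  haveI : NumberField L := NumberField.mk
  letI : Algebra F L := ι.toRingHom.toAlgebra
  have hshaW : W.ShaFinite := (hGZK W hr).2
  have hshaWd : Wd.ShaFinite := (hGZK Wd hrd).2
  haveI : Finite Wd.sha := hshaWd
  have hd' : MissingPPartAt Wd p := missingPPartAt_of_bsdp Wd p hd
  exact bsdp_of_missingPPartAt W p hGZK hr
    (missingPPartAt_of_twist_of_overF (L := L) p hmod hMilneC hDD hArtin hBC3 hBC6 hK2 hF3 hf hdisc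
      h6 hgal hWd hVF hVF' hshaW hshaWd hshaF hshaF' hd' hF hF')

/-- **Door B, closed form (any `p`): the `p`-parts over `F` + UPPER half for `E` + LOWER half for
`E^{(d_K)}` over `ℚ` ⟹ `BSD(E,p) ∧ BSD(E^{(d_K)},p)`.** [folklore] -/
theorem bsdp_pair_of_overCubicResolvent_of_upper_lower (hF : MissingPPartOverCAt VF p)
    (hF' : MissingPPartOverCAt VF' p) (hu : MissingUpperBoundAt W p)
    (hl : MissingLowerBoundAt Wd p) : BSDp W p ∧ BSDp Wd p := by
  obtain ⟨L, hfd, h3, hab, hgal, h6, ⟨ι⟩, -⟩ := exists_resolventClosure hK2 F hF3 hf hdisc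
  haveI := hfd
  haveI : FiniteDimensional ℚ L := Module.Finite.trans K L
  haveI : CharZero L := charZero_of_injective_algebraMap (algebraMap K L).injective
  haveI : NumberField L := NumberField.mk
  letI : Algebra F L := ι.toRingHom.toAlgebra
  have hshaW : W.ShaFinite := (hGZK W hr).2
  have hshaWd : Wd.ShaFinite := (hGZK Wd hrd).2
  obtain ⟨hW, hD⟩ := missingPPartAt_pair_of_overF_of_upper_lower (L := L) p hmod hMilneC hDD hArtin
    hBC3 hBC6 hK2 hF3 hf hdisc h6 hgal hWd hVF hVF' hshaW hshaWd hshaF hshaF' hF hF' hu hl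
  exact ⟨bsdp_of_missingPPartAt W p hGZK hr hW, bsdp_of_missingPPartAt Wd p hGZK hrd hD⟩

/-- **Door B, closed form, mirrored halves.** [folklore] -/
theorem bsdp_pair_of_overCubicResolvent_of_lower_upper (hF : MissingPPartOverCAt VF p)
    (hF' : MissingPPartOverCAt VF' p) (hl : MissingLowerBoundAt W p)
    (hu : MissingUpperBoundAt Wd p) : BSDp W p ∧ BSDp Wd p := by
  obtain ⟨L, hfd, h3, hab, hgal, h6, ⟨ι⟩, -⟩ := exists_resolventClosure hK2 F hF3 hf hdisc
  haveI := hfd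
  haveI : FiniteDimensional ℚ L := Module.Finite.trans K L
  haveI : CharZero L := charZero_of_injective_algebraMap (algebraMap K L).injective
  haveI : NumberField L := NumberField.mk
  letI : Algebra F L := ι.toRingHom.toAlgebra
  have hshaW : W.ShaFinite := (hGZK W hr).2
  have hshaWd : Wd.ShaFinite := (hGZK Wd hrd).2
  obtain ⟨hW, hD⟩ := missingPPartAt_pair_of_overF_of_lower_upper (L := L) p hmod hMilneC hDD hArtin
    hBC3 hBC6 hK2 hF3 hf hdisc h6 hgal hWd hVF hVF' hshaW hshaWd hshaF hshaF' hF hF' hl hu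
  exact ⟨bsdp_of_missingPPartAt W p hGZK hr hW, bsdp_of_missingPPartAt Wd p hGZK hrd hD⟩

/-- **Door C, closed form (exactness, any `p`): granted `BSD(E^{(d_K)},p)`, `BSD(E,p)` holds IFF
the `p`-adic defects of `E_F` and `E^{(d_K)}_F` agree** — so per class the `p`-part over `ℚ` at
an additive prime is EQUIVALENT to a statement about two curves with good reduction above `p`
over one cubic field (whenever `p = 𝔓³` in `F` and `Φ = C₃`). [folklore] -/
theorem bsdp_iff_defect_overCubicResolvent_eq (hd : BSDp Wd p) {qF qF' : ℚ}
    (hqF : shaAnOverC VF = (qF : ℂ)) (hqF' : shaAnOverC VF' = (qF' : ℂ)) :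
    BSDp W p ↔
      padicValRat p qF - padicValNat p VF.shaOrder =
        padicValRat p qF' - padicValNat p VF'.shaOrder := by
  obtain ⟨L, hfd, h3, hab, hgal, h6, ⟨ι⟩, -⟩ := exists_resolventClosure hK2 F hF3 hf hdisc
  haveI := hfd
  haveI : FiniteDimensional ℚ L := Module.Finite.trans K L
  haveI : CharZero L := charZero_of_injective_algebraMap (algebraMap K L).injective
  haveI : NumberField L := NumberField.mk
  letI : Algebra F L := ι.toRingHom.toAlgebra
  have hshaW : W.ShaFinite := (hGZK W hr).2
  have hshaWd : Wd.ShaFinite := (hGZK Wd hrd).2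
  haveI : Finite Wd.sha := hshaWd
  haveI : Finite W.sha := hshaW
  have hd' : MissingPPartAt Wd p := missingPPartAt_of_bsdp Wd p hd
  rw [← missingPPartAt_iff_defect_overF_eq (L := L) p hmod hMilneC hDD hArtin hBC3 hBC6 hK2 hF3 hf
    hdisc h6 hgal hWd hVF hVF' hshaW hshaWd hshaF hshaF' hd' hqF hqF']
  exact ⟨fun h => missingPPartAt_of_bsdp W p h, fun h => bsdp_of_missingPPartAt W p hGZK hr h⟩

end Closed





end Summit.BirchSwinnertonDyer.BirchSwinnertonDyer.Theorems.CubicResolvent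

end
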